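import Summits.Ventures.PercRepro.Night2StarCross
import Summits.Ventures.PercRepro.Night2StarLineAll

/-!
# PercRepro — night-2: every all-triangle basis of corank `≥ 19` satisfies `(★)` (blind cell pub-perc-repro, night-2 gen 1)

An ALL-TRIANGLE basis `B` of `G` (every fundamental circuit has three points: `m(B ∪ {x}) + 2 = q` for every `x ∈ G ∖ B`) puts
each outside point `x` on the B-line `line(x) = ncl(B ∪ {x}) ∖ {x}` (two points of `B`). Either all the lines coincide — then every
`x` lies in the closure of that pair and `rec_ge_of_line` (`Night2StarLineAll`) applies — or the points split into the class `A` of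
some `x₀`'s line and its nonempty complement `C`, and the `|A|·|C| ≥ |A| + |C| − 1 = d − 1 ≥ 18` pairs `A × C` are cross pairs
(`rec_ge_of_cross_pairs`, `Night2StarCross`). Theorem 11(iii) of `proofs/NIGHT-2-star.md` for `d ≥ 19`, in the kernel:
* **`rec_ge_of_all_triangle`** — `d ≥ 19`, every `x ∈ G ∖ B` a triangle point ⇒ `rec(B) ≥ 2/(q + 1)`.
-/

namespace PercRepro.Star

open Finset ThmH SixFour GenQ

variable {α : Type*} [DecidableEq α] {M : Matroid α} [M.Finite]

/-- A triangle point lies in the closure of its B-line. -/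
theorem mem_closure_line_of_triangle (hs : Simple M) {G B : Finset α} {q : ℕ} (hG : G ⊆ gr M)
    (hrG : M.eRk (G : Set α) = (q : ℕ∞)) (hB : B ∈ Bq M G q) {x : α} (hx : x ∈ G \ B)
    (hm : mTr M (insert x B) + 2 = q) : x ∈ M.closure (((circ M B x).erase x : Finset α) : Set α) := by
  have hxB := (Finset.mem_sdiff.1 hx).2
  have hxG := (Finset.mem_sdiff.1 hx).1
  have hxin : x ∈ circ M B x := by
    unfold circ
    exact Finset.mem_sdiff.2 ⟨Finset.mem_insert_self x B, notMem_coloopsOf_insert hG hrG hB hx⟩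
  have hLB : (circ M B x).erase x ⊆ B := line_subset
  have hcard := card_line_of_triangle hG hrG hB hx hm
  -- the line `{a, b}` is independent (simple)
  obtain ⟨a, b, hab, hL⟩ := Finset.card_eq_two.1 hcard
  have haB : a ∈ B := hLB (by rw [hL]; simp)
  have hbB : b ∈ B := hLB (by rw [hL]; simp)
  have hind : M.Indep ((({a, b} : Finset α)) : Set α) := by
    apply indep_of_eRk_eq_of_card_eq (q := 2)
    · have := two_le_eRk_of_two_mem hs (show ({a, b} : Finset α) ⊆ gr M from
        fun z hz => by
          rw [Finset.mem_insert, Finset.mem_singleton] at hz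
          rcases hz with rfl | rfl
          · exact (mem_Bq.1 hB).1.trans hG haB
          · exact (mem_Bq.1 hB).1.trans hG hbB) (by simp) (by simp) hab
      have h2 : M.eRk ((({a, b} : Finset α)) : Set α) ≤ 2 := by
        have := M.eRk_le_encard ((({a, b} : Finset α)) : Set α)
        rw [Set.encard_coe_eq_coe_finsetCard, Finset.card_pair hab] at this
        exact_mod_cast this
      exact le_antisymm h2 this
    · exact Finset.card_pair hab
  rw [hL]
  by_contra hcl
  have hxE : x ∈ M.E := by
    rw [← coe_gr M]
    exact Finset.mem_coe.2 (hG hxG)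
  have hxab : x ∉ (({a, b} : Finset α) : Set α) := by
    rw [Finset.coe_insert, Finset.coe_singleton, Set.mem_insert_iff, Set.mem_singleton_iff, not_or]
    exact ⟨fun h => hxB (h ▸ haB), fun h => hxB (h ▸ hbB)⟩
  have hind' := (hind.notMem_closure_iff_of_notMem hxab hxE).1 hcl
  -- but `insert x {a, b} = circ M B x` is dependent
  have heq : (insert x ({a, b} : Finset α) : Finset α) = circ M B x := by
    rw [← hL, Finset.insert_erase hxin]
  apply not_indep_sdiff_coloopsOf_insert hG hrG hB hx
  rw [← Finset.coe_insert] at hind'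
  show M.Indep ((circ M B x : Finset α) : Set α)
  rw [← heq]
  exact hind'

/-- **Every all-triangle basis of corank `≥ 19` satisfies `(★)`.** -/
theorem rec_ge_of_all_triangle (hs : Simple M) {G B : Finset α} {q : ℕ} (hG : G ⊆ gr M)
    (hrG : M.eRk (G : Set α) = (q : ℕ∞)) (hB : B ∈ Bq M G q) (hq : 2 ≤ q)
    (htri : ∀ x ∈ G \ B, mTr M (insert x B) + 2 = q) (hd : 19 ≤ (G \ B).card) :
    2 / ((q : ℚ) + 1) ≤ rec M G q B := by
  obtain ⟨x₀, hx₀⟩ : (G \ B).Nonempty := Finset.card_pos.1 (by omega)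
  by_cases hall : ∀ x ∈ G \ B, (circ M B x).erase x = (circ M B x₀).erase x₀
  · -- the pure line through 
    have hcard := card_line_of_triangle hG hrG hB hx₀ (htri x₀ hx₀)
    obtain ⟨a, b, hab, hL⟩ := Finset.card_eq_two.1 hcard
    have hLB : (circ M B x₀).erase x₀ ⊆ B := line_subset
    have haB : a ∈ B := hLB (by rw [hL]; simp)
    have hbB : b ∈ B := hLB (by rw [hL]; simp)
    apply rec_ge_of_line hs hG hrG hB hq haB hbB hab _ (by omega)
    intro x hx
    have h := mem_closure_line_of_triangle hs hG hrG hB hx (htri x hx)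
    rw [hall x hx, hL, Finset.coe_insert, Finset.coe_singleton] at h
    exact h
  · -- two different lines: the class of  against the rest
    push Not at hall
    obtain ⟨y, hy, hyL⟩ := hall
    set A := (G \ B).filter (fun x => (circ M B x).erase x = (circ M B x₀).erase x₀) with hA
    set C := (G \ B).filter (fun x => ¬ ((circ M B x).erase x = (circ M B x₀).erase x₀)) with hC
    have hx₀A : x₀ ∈ A := Finset.mem_filter.2 ⟨hx₀, rfl⟩
    have hyC : y ∈ C := Finset.mem_filter.2 ⟨hy, hyL⟩
    have hAC : A.card + C.card = (G \ B).card :=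
      Finset.card_filter_add_card_filter_not (fun x => (circ M B x).erase x = (circ M B x₀).erase x₀)
    have hA1 : 1 ≤ A.card := Finset.card_pos.2 ⟨x₀, hx₀A⟩
    have hC1 : 1 ≤ C.card := Finset.card_pos.2 ⟨y, hyC⟩
    have hprod : 18 ≤ A.card * C.card := by nlinarith
    set P : Finset (Finset α) := (A ×ˢ C).image (fun p : α × α => ({p.1, p.2} : Finset α)) with hP
    have hdisj : ∀ z, z ∈ A → z ∈ C → False := fun z hz hz' =>
      (Finset.mem_filter.1 hz').2 (Finset.mem_filter.1 hz).2
    have hinj : Set.InjOn (fun p : α × α => ({p.1, p.2} : Finset α)) ((A ×ˢ C : Finset (α × α)) : Set (α × α)) := by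
      intro p hp p' hp' heq
      rw [Finset.mem_coe, Finset.mem_product] at hp hp'
      simp only at heq
      have h1 : p.1 ∈ ({p'.1, p'.2} : Finset α) := by rw [← heq]; simp
      have h2 : p.2 ∈ ({p'.1, p'.2} : Finset α) := by rw [← heq]; simp
      simp only [Finset.mem_insert, Finset.mem_singleton] at h1 h2
      rcases h1 with h1 | h1
      · rcases h2 with h2 | h2
        · exact absurd (h2 ▸ hp.2) (fun h => hdisj p'.1 hp'.1 h)
        · exact Prod.ext h1 h2
      · exact absurd (h1 ▸ hp.1) (fun h => hdisj p'.2 h hp'.2)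
    have hPcard : P.card = A.card * C.card := by
      rw [hP, Finset.card_image_of_injOn hinj, Finset.card_product]
    have hPsub : P ⊆ (G \ B).powersetCard 2 := by
      intro p hp
      rw [hP, Finset.mem_image] at hp
      obtain ⟨⟨u, v⟩, huv, rfl⟩ := hp
      rw [Finset.mem_product] at huv
      have huD := (Finset.mem_filter.1 huv.1).1
      have hvD := (Finset.mem_filter.1 huv.2).1
      have hne : u ≠ v := fun h => hdisj u huv.1 (h ▸ huv.2)
      rw [Finset.mem_powersetCard]
      refine ⟨?_, Finset.card_pair hne⟩
      intro z hz
      rw [Finset.mem_insert, Finset.mem_singleton] at hz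
      rcases hz with rfl | rfl
      · exact huD
      · exact hvD
    have hcross : ∀ p ∈ P, ∃ x y, x ≠ y ∧ p = {x, y} ∧ CrossPair M B q x y := by
      intro p hp
      rw [hP, Finset.mem_image] at hp
      obtain ⟨⟨u, v⟩, huv, rfl⟩ := hp
      rw [Finset.mem_product] at huv
      have huD := (Finset.mem_filter.1 huv.1).1
      have hvD := (Finset.mem_filter.1 huv.2).1
      have hne : u ≠ v := fun h => hdisj u huv.1 (h ▸ huv.2)
      refine ⟨u, v, hne, rfl, htri u huD, htri v hvD, ?_⟩
      rw [(Finset.mem_filter.1 huv.1).2]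
      exact fun h => (Finset.mem_filter.1 huv.2).2 h.symm
    exact rec_ge_of_cross_pairs hs hG hrG hB hPsub hcross (by rw [hPcard]; exact hprod)

end PercRepro.Star
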